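import Summits.ResolutionOfSingularities.ResolutionOfSingularities.Theorems.FrobeniusLadderFInjectiveMacaulayficationFDStorey2L1FanChecksB
import HarnessLib

/-!
# BED D STOREY 2 — RAW KERNEL CHECKS II (strict transforms, Fedder cells) AND THE BINDERS of `CICertificates.ciCertificates`
(crux `FInjectiveMacaulayfication` stmt-ResolutionOfSingularities-15315, chain w45a, BED D = `f_D = z⁴ + x⁵z + x⁶ + y³ + u³ + t⁷` (char 2), ROW #8 «f4pos_rowD_twoStorey»,
route of record (W8) = LOCAL SECOND STOREY WITH AN `𝔪_P`-PRIMARY TORIC CENTRE (res-L1-w45a-plan-1 R21.29–R21.34, CHAIN v33.9): storey 2 at the point `P` of storey 1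
(res-L1-w45a-tri-2 g17 memo `Q13-fD-tri2.md` §5/§9, chart 277 of `Σ_D^(𝔪K)`), local equation `G = Y₃² + Y₁³ + Y₂³ + Y₄Y₅⁴ + Y₄²Y₅ + Y₃Y₄Y₅⁴ + Y₃Y₄²Y₅` =
`X 2 ^ 2 + X 0 ^ 3 + X 1 ^ 3 + X 3 * X 4 ^ 4 + X 3 ^ 2 * X 4 + X 2 * X 3 * X 4 ^ 4 + X 2 * X 3 ^ 2 * X 4` (`X 0..X 4 = Y₁..Y₅`; specimen package `FDStorey2Specimen`, ✓p663116/p663407).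
Certificate `L/res-L1-w45a-stub-3/g11/cons/storey2/FDStorey2-L1-product-toric-cert-final.json` sha256/16 `c79427d7cbc1bdce` (res-L1-w45a-stub-2 g9 schema toric-cert-v1.3;
FAN = res-L1-w45a-tri-2 g17 line L1 `fanW8_L1.json` (kit j318216, memo `W8-PRIMARY-tri2.md` 43fc35e2781a9b97): Σ(𝔪_P) starred at (2,2,2,2,1), then at (2,2,3,3,1) — 15 unimodular cones on
8 rays; only POSITIVE rays are added, so every proper face of the orthant survives and `X_Σ → 𝔸⁵` is an isomorphism off `P`; support function `h = (4, 6, 7)` on the three positive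
rays (tri-2, margins ≥ 1), `K″ = {Y^m : |m| ≥ 4, ⟨m,(2,2,2,2,1)⟩ ≥ 6, ⟨m,(2,2,3,3,1)⟩ ≥ 7}` (`𝔪_P`-primary); `build_cert_s3.py` (stub-2's `build_cert.py` with a (cones, h) entry and
edge-adjacency cover records), `finalize_cert.py`, GENERATED by `gen_s2.py`; seat res-L1-w45a-stub-3 g11).
[OURS · L1 W4.5a] — NOT a statement of any manuscript; AI-written (script-generated from the certificate), weaker than expert review.

`hA0AJ_raw`, `hprim_raw` (pure powers of all five variables), `hθ_raw`, `hX_raw`, `hcheck`, `hS_raw`; binders `hprimAJ`, `hm haA hV hgen hge hcov hθF₀ hunit hv hX hg0`, `hSS`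
(univ form, for `RoadBFrame.hon_of_kernelChecks`) — the binder shape of res-L1-w45a-stub-2's fan modules (`…Lx6c5PointKChar2Fan` etc.), same names.
Consumer: `…FDStorey2L1BlowupFull` (Bl_(I_A) V(G) FULL at every point: over `P` by `RoadBFrame.hon_of_kernelChecks` + `CICertificates.ciCertificates`, off `P` by `FDStorey2Specimen.regular_off_vertex`) → res-L1-w45a-stub-1's row #8 via ✓p664865 `localSecondStorey_of_affineModel` / ✓p664558.
No named facts. [folklore; cite: CoxLittleSchenck2011, §2.3; Fedder1983, Thm. 1.12]
-/

-- single-problem summit: the doubled namespace component is forced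
set_option linter.dupNamespace false

noncomputable section

namespace Summit.ResolutionOfSingularities.ResolutionOfSingularities.Theorems.FInjectiveMacaulayfication.FDStorey2L1Fan

open MvPolynomial
open Summit.ResolutionOfSingularities.ResolutionOfSingularities.Theorems.FInjectiveMacaulayfication

/-! ## §2 Raw kernel checks (continued) -/

/-- `0 ∉ AL`, every generator involves some variable, and the table length. -/
theorem hA0AJ_raw : (0 : Fin 5 → ℕ) ∉ AL ∧ (∀ v ∈ AL, ∃ j : Fin 5, 0 < v j) ∧ AL.length = 41 := by decide +kernel

/-- The pure powers of all five variables in `A` (the centre is `𝔪_P`-primary). -/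
theorem hprim_raw : (Pi.single 0 4 : Fin 5 → ℕ) ∈ AL ∧ (Pi.single 1 4 : Fin 5 → ℕ) ∈ AL ∧ (Pi.single 2 4 : Fin 5 → ℕ) ∈ AL ∧ (Pi.single 3 4 : Fin 5 → ℕ) ∈ AL ∧ (Pi.single 4 7 : Fin 5 → ℕ) ∈ AL := by decide +kernel

/-- The `θ`-factorisation witnesses: termwise `V_c · e = d_c + e'`, equal coefficients. -/
theorem hθ_raw : ∀ c : Fin 15, List.Forall₂ (fun t t' : ℤ × (Fin 5 → ℕ) => t.1 = t'.1 ∧ (V c).mulVec t.2 = dv c + t'.2) FL (G c) := by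
  decide +kernel

/-- For every chart and variable, a term of `g_c` free of that variable whose coefficient class is odd. -/
theorem hX_raw : ∀ (c : Fin 15) (i : Fin 5), ∃ t ∈ G c, t.2 i = 0 ∧
    ¬ ((2 : ℤ) ∣ (((G c).filter fun s : ℤ × (Fin 5 → ℕ) => s.2 = t.2).map fun s : ℤ × (Fin 5 → ℕ) => s.1).sum) := by
  decide +kernel

/-- THE FEDDER CERTIFICATES, charts 0–14: the kernel cell check at `p = 2`. -/
theorem hcheck_0 : ∀ c : Fin 15, 0 ≤ c.val → c.val < 15 → KLocCellKit.checkKs 2 (G c) (CELLS c) = true := by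
  decide +kernel

/-- ★ THE FEDDER CERTIFICATES: every chart passes the kernel cell check at `p = 2`. -/
theorem hcheck : ∀ c : Fin 15, KLocCellKit.checkKs 2 (G c) (CELLS c) = true := by
  intro c
  · exact hcheck_0 c (by omega) c.isLt

/-- Every chart carries the cell `S = ∅`. -/
theorem hS_raw : ∀ c : Fin 15, (∅ : Finset (Fin 5)) ∈ (CELLS c).map Prod.fst := by decide +kernel

/-- The (thin) cells cover every zero pattern (the covering hypothesis of `RoadBFrame.hon_of_kernelChecks` / `KLocCellRange.honQuot_of_kLocCells_range` with `J` = (Finset.univ : Finset (Fin 5)); the premise is not used). -/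
theorem hSS : ∀ (c : Fin 15) (T : Finset (Fin 5)), (∀ j ∈ (Finset.univ : Finset (Fin 5)), ∃ i ∈ T, 0 < V c i j) →
    ∃ S ∈ (CELLS c).map Prod.fst, S ⊆ T :=
  fun c T _ => ⟨∅, hS_raw c, Finset.empty_subset T⟩

/-! ## §3 The binders of `CICertificates.ciCertificates` (`J` = univ) -/

/-- ★ THE CENTRE BINDERS (`J` = (Finset.univ : Finset (Fin 5))): every generator involves a variable (`hAJ`), and pure powers of all variables lie in `A` (`hprim`);
`|AL|` keeps the statement specimen-distinct. Use `hprimAJ.1` for `hAJ` and `hprimAJ.2.1` for `hprim`. -/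
theorem hprimAJ : (∀ e ∈ A, ∃ j ∈ (Finset.univ : Finset (Fin 5)), 0 < e j) ∧
    (∀ j ∈ (Finset.univ : Finset (Fin 5)), ∃ N : ℕ, Finsupp.single j N ∈ A) ∧ AL.length = 41 := by
  obtain ⟨-, hAJ, hlen⟩ := hA0AJ_raw
  obtain ⟨h0, h1, h2, h3, h4⟩ := hprim_raw
  refine ⟨fun e he => ?_, fun j hj => ?_, hlen⟩
  · obtain ⟨v, hv, rfl⟩ := Q6CNKit.exists_of_mem_image_symm AL e he
    obtain ⟨j, hj⟩ := hAJ v hv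
    exact ⟨j, Finset.mem_univ j, by rw [Finsupp.coe_equivFunOnFinite_symm]; exact hj⟩
  · fin_cases j
    · exact ⟨4, Q6CNKit.single_mem AL 0 4 h0⟩
    · exact ⟨4, Q6CNKit.single_mem AL 1 4 h1⟩
    · exact ⟨4, Q6CNKit.single_mem AL 2 4 h2⟩
    · exact ⟨4, Q6CNKit.single_mem AL 3 4 h3⟩
    · exact ⟨7, Q6CNKit.single_mem AL 4 7 h4⟩

/-- The vertices are generators. -/
theorem hm : ∀ c : Fin 15, m c ∈ A := fun c => (Q6CNKit.mem_image_symm AL (mv c)).mpr (hm_raw c)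

/-- The neighbours are generators. -/
theorem haA : ∀ (c : Fin 15) (i : Fin 5), a c i ∈ A := fun c i => (Q6CNKit.mem_image_symm AL (av c i)).mpr (haA_raw c i)

/-- The chart matrices are unimodular. -/
theorem hV : ∀ c : Fin 15, IsUnit (((V c).map (Nat.cast : ℕ → ℤ)).det) := fun c => Matrix.isUnit_det_of_left_inverse (hV_raw c)

/-- (hgen) `V_c a_c i = V_c m_c + e_i`. -/
theorem hgen : ∀ (c : Fin 15) (i : Fin 5), (Finsupp.equivFunOnFinite.symm ((V c).mulVec ⇑(a c i)) : Fin 5 →₀ ℕ) =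
    Finsupp.equivFunOnFinite.symm ((V c).mulVec ⇑(m c)) + Finsupp.single i 1 :=
  fun c i => Q6CNKit.hgen_of_vec (V c) (av c i) (mv c) i (hgen_raw c i)

/-- (h≥) `m_c` minimises every row of `V_c` over `A`. -/
theorem hge : ∀ (c : Fin 15), ∀ e ∈ A, (Finsupp.equivFunOnFinite.symm ((V c).mulVec ⇑(m c)) : Fin 5 →₀ ℕ) ≤
    Finsupp.equivFunOnFinite.symm ((V c).mulVec ⇑e) :=
  fun c => Q6CNKit.hge_of_vec (V c) AL (mv c) (hge_raw c)

/-- `hcov`: the cover identities `(Y^e)^K = Y^(m c) · y`, `y ∈ I_A^(K-1)` (`MonomialCoverRecord.hcov_of_record` per record, `b = m c₂`). -/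
theorem hcov (k : Type) [Field k] : ∀ e ∈ A, ∃ (c : Fin 15) (K : ℕ), 1 ≤ K ∧
    ∃ y ∈ (Ideal.span ((fun b : Fin 5 →₀ ℕ => (MvPolynomial.monomial b (1 : k) : MvPolynomial (Fin 5) k)) '' (A : Set (Fin 5 →₀ ℕ)))) ^ (K - 1),
      (MvPolynomial.monomial e (1 : k) : MvPolynomial (Fin 5) k) ^ K = MvPolynomial.monomial (m c) 1 * y := by
  intro e he
  obtain ⟨v, hv, rfl⟩ := Q6CNKit.exists_of_mem_image_symm AL e he
  obtain ⟨rec, -, hK, hid⟩ := P2d4CChar2Fan.exists_of_forall₂ hrec_raw v hv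
  refine MonomialCoverRecord.hcov_of_record k A m _ rec.1 rec.2.1 hK (m rec.2.2.1)
    (Finsupp.equivFunOnFinite.symm rec.2.2.2) (hm rec.2.2.1) ?_
  show rec.2.1 • (Finsupp.equivFunOnFinite.symm v : Fin 5 →₀ ℕ) = Finsupp.equivFunOnFinite.symm (mv rec.1) +
    (rec.2.1 - 1) • Finsupp.equivFunOnFinite.symm (mv rec.2.2.1) + Finsupp.equivFunOnFinite.symm rec.2.2.2
  rw [← Q6CNKit.symm_nsmul, hid, Q6CNKit.symm_add, Q6CNKit.symm_add, Q6CNKit.symm_nsmul]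

/-- `G` is the value of the term list `FL`. [folklore] -/
theorem f_eq_evalL (k : Type) [Field k] :
    (X 2 ^ 2 + X 0 ^ 3 + X 1 ^ 3 + X 3 * X 4 ^ 4 + X 3 ^ 2 * X 4 + X 2 * X 3 * X 4 ^ 4 + X 2 * X 3 ^ 2 * X 4 : MvPolynomial (Fin 5) k) = KLocCellKit.evalL k FL := by
  simp only [KLocCellKit.evalL, FL, List.map_cons, List.map_nil, List.sum_cons, List.sum_nil, Int.cast_one,
    PConeFedderData.monomial_five]
  ring

/-- `hθF`: `θ_(V c) G = Y^(d c) · g_c` with `g_c = KLocCellKit.evalL k (G c)`. -/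
theorem hθF₀ (k : Type) [Field k] : ∀ c : Fin 15,
    aeval (fun j : Fin 5 => ∏ i : Fin 5, (X i : MvPolynomial (Fin 5) k) ^ V c i j) (X 2 ^ 2 + X 0 ^ 3 + X 1 ^ 3 + X 3 * X 4 ^ 4 + X 3 ^ 2 * X 4 + X 2 * X 3 * X 4 ^ 4 + X 2 * X 3 ^ 2 * X 4 : MvPolynomial (Fin 5) k) =
      monomial (d c 0) (1 : k) * KLocCellKit.evalL k (G c) := by
  intro c
  rw [f_eq_evalL]
  exact CIPolyKit.theta_evalL (V c) (dv c) FL (G c) (hθ_raw c)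

/-- `hunit`: `N • m_c = Σ_j d_c j • a_c j + r'`. -/
theorem hunit : ∀ (c : Fin 15) (l : Fin 1), ∃ (N : ℕ) (r' : Fin 5 →₀ ℕ), N • m c = ∑ j : Fin 5, d c l j • a c j + r' := by
  intro c l
  refine ⟨Nu c, Finsupp.equivFunOnFinite.symm (rv c), ?_⟩
  show Nu c • (Finsupp.equivFunOnFinite.symm (mv c) : Fin 5 →₀ ℕ) =
    ∑ j : Fin 5, (Finsupp.equivFunOnFinite.symm (dv c) : Fin 5 →₀ ℕ) j • (Finsupp.equivFunOnFinite.symm (av c j) : Fin 5 →₀ ℕ) +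
      Finsupp.equivFunOnFinite.symm (rv c)
  rw [P2d4CChar2Fan.symm_sum_smul, ← Q6CNKit.symm_add, ← Q6CNKit.symm_nsmul, hunit_raw c]

/-- `hv`: the vertex monomials lie in the image of `I_A` modulo any `(Fs)` (use `hv k ![G]`). -/
theorem hv (k : Type) [Field k] : ∀ (Fs : Fin 1 → MvPolynomial (Fin 5) k) (c : Fin 15),
    Ideal.Quotient.mk (Ideal.span (Set.range Fs)) (monomial (m c) (1 : k)) ∈
      Ideal.span ((fun e : Fin 5 →₀ ℕ => Ideal.Quotient.mk (Ideal.span (Set.range Fs)) (monomial e (1 : k))) '' (A : Set (Fin 5 →₀ ℕ))) :=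
  fun _ c => Ideal.subset_span ⟨m c, Finset.mem_coe.mpr (hm c), rfl⟩

/-! ## §4 Cell-side constants -/

/-- No variable divides a strict transform (`¬ Yᵢ ∣ g_c`). -/
theorem hX (k : Type) [Field k] [CharP k 2] : ∀ (c : Fin 15) (i : Fin 5), ¬ (X i ∣ KLocCellKit.evalL k (G c)) := by
  intro c
  unfold KLocCellKit.evalL
  exact NotDvdOfSupport.forall_not_X_dvd_evalL 2 (G c) (hX_raw c)

/-- The strict transforms are non-zero. -/
theorem hg0 (k : Type) [Field k] [CharP k 2] : ∀ c : Fin 15, KLocCellKit.evalL k (G c) ≠ 0 :=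
  fun c h => hX k c 0 (by rw [h]; exact dvd_zero _)

end Summit.ResolutionOfSingularities.ResolutionOfSingularities.Theorems.FInjectiveMacaulayfication.FDStorey2L1Fan

end
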